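import Summits.Langlands.Langlands.Theses.IrreducibilityBySelfDuality
import Summits.Langlands.Langlands.Theorems.IrreducibilityBySelfDualityGaloisRepOfRegularAlgebraic
import Literature.NumberTheory.Automorphic.ReciprocityGLnRankOneProofs
import Literature.NumberTheory.GaloisRepresentations.WeakAbelianDirectSummandCyclotomicProofs
import Literature.NumberTheory.Automorphic.GLOneArchParameterOfAlgebraicCharacter
import Literature.NumberTheory.Automorphic.GLOneOfHeckeCharacterBJ
import Literature.NumberTheory.Automorphic.BockleHuiIrreducibleGL3AnalyticProofs
import Literature.NumberTheory.Automorphic.ChebotarevArtinRepHolds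
import Literature.NumberTheory.GaloisRepresentations.LAdicRepFrobenius
import Literature.NumberTheory.GaloisRepresentations.FramedRepEquivConj
import Literature.NumberTheory.GaloisRepresentations.OddAbsolutelyIrreducibleProofs
import Literature.FieldTheory.AlgClosed.PadicAlgClEquivComplex

/-!
# Disproof of `GaloisRepOfRegularAlgebraic` (crux stmt-Langlands-10785) — findings

Standing disprover's work-file (refuter-cdisprove-stmt-Langlands-10785-0, cycle 1, 2026-08-16).
Prose only in docstrings; every `theorem` below is kernel-checked (no `sorry` in this version).

## Verdict: NO KILL — the crux is a printed theorem, faithfully transcribed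

The crux is VERBATIM the named fact `exists_galoisRep_of_regularAlgebraic` (lang.S27 = HLTT Thm. A +
Scholze Cor. V.4.2 + Varma Thm. 1; `crux_iff_fact`).  Attack surface and why each attack fails:

1. SMALL MODELS.  `n = 0` and `n = 1` are THEOREMS in the tree for every number field
   (`crux_rank_le_one` = `of_rank_le_one`: Weil 1956 via `HeckeCharacter.IsAlgebraic.exists_lAdic`);
   for `n ≥ 2` no `CuspidalAutomorphicRepData n K hcpt` is constructible (a cusp form on `GL_n`,
   `n ≥ 2`, would be needed), so no junk-model refutation can even be typed.  The datum formalism is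
   faithful in rank one: a stable line `W/W'` of automorphic forms on `GL₁` IS an idele class
   character (`exists_heckeCharacter_glOne`), and `HasArchParameter` reads the genuine Lie derivative
   (`hasLieAction_unique`), so "regular algebraic" = type `A₀`.
2. NORMALISATION (the planner's stated risk "q_v vs q_v⁻¹, C- vs L-").  The two invertible slips are
   ABSORBED by `∃ r`: `α ↦ α⁻¹` (arithmetic vs geometric Frobenius, `π ↦ π^∨`) is undone by `r ↦ r^∨`,
   and `q^{(n-1)/2} ↦ q^{-(n-1)/2}` by `r ↦ r ⊗ χ_cyc^{±(n-1)}`; only a HALF-integral slip (missing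
   `(√q)^{n-1}` for even `n`) would falsify, and the text has `(√q)^{m-1}` with `m = n`
   (`arithFrobPolyOfSatake`).  Certified on the basic infinite-order example: for `π = π_{‖·‖}` the
   predicted polynomial is `X - N v` (`satakeParam_eq_of_normDatum`, `arithFrobPolyOfSatake_one`),
   i.e. `r = χ_ℓ` (arithmetic Frobenius ↦ `N v`), which is exactly what `rank_one` provides.
3. LOAD-BEARING HYPOTHESES (drop one at a time):
   * `v ∤ ℓ` (the guard `((ℓ : ℕ) : 𝓞 K) ∉ v.asIdeal`): LOAD-BEARING — PROVED FALSE without it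
     (`galoisRepOfRegularAlgebraic_false_without_primeToEll`, landed as
     `Theorems/GaloisRepOfRegularAlgebraic/Negative/FalseWithoutPrimeToEll.lean`, p99994): for
     `π_{‖·‖}` at `v ∣ ℓ` the Frobenius value `N v` is not an `ℓ`-adic unit, while every rank-one
     continuous `r : Γ_K → GL₁(ℚ̄_ℓ)` takes unit values (`norm_apply_eq_one_of_rank_one`, `Γ_K` compact).
   * `π.1.IsRegularAlgebraic`: LOAD-BEARING — PROVED FALSE without it
     (`galoisRepOfRegularAlgebraic_false_without_regularAlgebraic`, landed as
     `Theorems/GaloisRepOfRegularAlgebraic/Negative/FalseWithoutRegularAlgebraic.lean`, p102360):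
     witness `π_{‖·‖^{1/2}}` (`exists_halfNormCharacter`); the predicted Frobenius values `ι⁻¹√(N v)`
     square to `N v = χ_ℓ(Frob_v)`, so `r²` and `χ_ℓ` agree at a.e. Frobenius, hence are EQUIVALENT
     (`nonempty_equiv_of_hasFrobCharpolyAt_eventually chebotarev_artinRep_holds`, proved in tree),
     hence equal; at a complex conjugation `c`: `1 = (r c)₀₀² = χ_ℓ(c) = -1`, absurd.
   * `IsTotallyReal K ∨ IsCMField K`: NOT REFUTABLE — without it the statement is the OPEN
     Clozel–Fontaine–Mazur expectation (Galois representations for regular algebraic cuspidal `π` over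
     an arbitrary number field); no counterexample is known or expected.  Recorded as a `def` only.
   * cuspidality / `IsSemisimple`: weakening the conclusion or widening to isobaric `π` stays TRUE
     (Eisenstein: sums of the constituents' representations); nothing to refute.
4. NATURAL STRENGTHENINGS refuted: compatibility at `v ∣ ℓ` (item 3); "`r` of finite order"
   (`not_crux_with_finiteOrder`: `χ_ℓ(Frob_v) = N v` has infinite order) — the crux is genuinely
   `ℓ`-adic, not Artin.
5. LINE `Sketch` (lead prover-line-stmt-Langlands-10785-0; stubs S1–S7): every stub is TRUE as
   typed (S1 = HLTT Thm. A; S2 = Varma Thm. 1 in trace form, true even in degree `0`; S3 = JS (2.5)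
   gap; S4–S7 provable algebra) and the composition is kernel-checked, so the line smuggles no gap.
   Cheap findings for the workers, kernel-checked in § Line: the hypotheses `0 ∉ α` of S4 and `0 ∉ β`
   of S7 are REDUNDANT (implied by the gap, `zero_not_mem_of_gap`); `0 < q` in S4 is load-bearing
   only at the junk value `q = 0` (`gapTransport_false_at_zero`); S5's gap hypothesis is
   unsatisfiable at `q = 1`, `n ≥ 1` (`monodromyGap_hyp_false_at_one`, harmless since `q_v ≥ 2`) and
   S5 is false without it (`monodromyGap_false_without_gap`).

## Index
* § Crux: `Crux`, `crux_iff_fact`, `crux_rank_le_one`.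
* § Galois: `norm_apply_eq_one_of_rank_one`, `norm_eq_one_of_hasFrobCharpolyAt`, `norm_residueCard_lt_one`.
* § NormDatum: `exists_normDatum`, `heckeCharacter_of_span`, `isRegularAlgebraic_normDatum`,
  `satakeParam_eq_of_normDatum`, `exists_hasSatakeParamAt_normDatum`, `not_hasFrobCharpolyAt_normDatum_above`.
* § LoadBearing: `GaloisRepOfRegularAlgebraicWithoutPrimeToEll` + `_false_without_primeToEll` (PROVED);
  `GaloisRepOfRegularAlgebraicWithoutRegularAlgebraic` + `_false_without_regularAlgebraic` (PROVED);
  `GaloisRepOfRegularAlgebraicWithoutCMorTR` (OPEN, no theorem).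
* § Strengthenings: `not_crux_with_finiteOrder`.
* § Line Sketch: `zero_not_mem_of_gap`, `gapTransport_false_at_zero`, `monodromyGap_false_without_gap`,
  `monodromyGap_hyp_false_at_one`.
-/

noncomputable section

set_option linter.dupNamespace false

open scoped MatrixGroups Matrix NumberField Polynomial Classical NNReal
open NumberField IsDedekindDomain Field Polynomial Filter
open Literature.NumberTheory.Automorphic Literature.NumberTheory.GaloisRepresentations

namespace Summit.Langlands.Langlands.Cruxes.GaloisRepOfRegularAlgebraic.Disproof

/-! ## § Crux -/

/-- The crux under attack, by name. -/
abbrev Crux : Prop :=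
  Summit.Langlands.Langlands.Theses.IrreducibilityBySelfDuality.GaloisRepOfRegularAlgebraic

/-- The crux is the named fact lang.S27 (`Theorems/…GaloisRepOfRegularAlgebraic.lean`, `iff_fact`). -/
theorem crux_iff_fact : Crux ↔ exists_galoisRep_of_regularAlgebraic :=
  Summit.Langlands.Langlands.Theorems.GaloisRepOfRegularAlgebraic.iff_fact

/-- **Small models are theorems**: the crux restricted to `n ≤ 1` HOLDS, for every number field
(`of_rank_le_one`: rank `0` degenerate, rank `1` = Weil 1956).  So no junk-model refutation exists in
the only ranks where a `CuspidalAutomorphicRepData` is constructible. -/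
theorem crux_rank_le_one :
    ∀ (n : ℕ), n ≤ 1 → ∀ (K : Type) [Field K] [NumberField K]
      (hcpt : isCompact_glFiniteIntegralLevel n K),
      (IsTotallyReal K ∨ IsCMField K) → ∀ (π : CuspidalAutomorphicRepData n K hcpt),
      π.1.IsRegularAlgebraic → ∀ (ℓ : ℕ) [Fact ℓ.Prime] (ι : PadicAlgCl ℓ ≃+* ℂ),
      ∃ r : FramedGaloisRep K (PadicAlgCl ℓ) n, r.toGaloisRep.IsSemisimple ∧
        ∀ (v : HeightOneSpectrum (𝓞 K)) (α : Multiset ℂ), π.1.HasSatakeParamAt v α →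
          ((ℓ : ℕ) : 𝓞 K) ∉ v.asIdeal →
            r.IsUnramifiedAt v ∧ r.HasFrobCharpolyAt v (arithFrobPolyOfSatake ι v.residueCard n α) :=
  Summit.Langlands.Langlands.Theorems.GaloisRepOfRegularAlgebraic.of_rank_le_one

/-! ## § Galois and § NormDatum — the rank-one toolkit (identical to the landed Negative file) -/


/-! ### The crux with the guard `ℓ ∉ v` dropped

`GaloisRepOfRegularAlgebraicWithoutPrimeToEll` (the name used in the crux work-file
`Cruxes/GaloisRepOfRegularAlgebraic/Disproof.lean`) is the text of the crux
(= `exists_galoisRep_of_regularAlgebraic`, lang.S27) with the hypothesis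
`((ℓ : ℕ) : 𝓞 K) ∉ v.asIdeal →` deleted from the place clause, i.e. unramified compatibility
demanded at EVERY finite place where `π` has a Satake parameter, including those above `ℓ`.  To
keep this file definition-free it is written out inline in the type of
`galoisRepOfRegularAlgebraic_false_without_primeToEll` below. -/

/-! ### Galois side: entries of a rank-one `ℓ`-adic character are `ℓ`-adic units -/

/-- **A continuous `r : Γ_K → GL₁(ℚ̄_ℓ)` takes `ℓ`-adic unit values**: `‖(r σ)₀₀‖ = 1` for every `σ`.
The map `σ ↦ ‖(r σ)₀₀‖` is a continuous homomorphism from the compact group `Γ_K` to the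
multiplicative group of positive reals; its image is bounded, and a bounded subgroup of `ℝ_{>0}` is
trivial (`MonoidHom.eq_one_of_pos_of_bddAbove`).  (Serre 1968, Ch. I §1.1: a compact subgroup of
`GL_n` over an `ℓ`-adic field has unit eigenvalues.) [cite: SerreAbelianLadic1968, Ch. I §1.1] -/
theorem norm_apply_eq_one_of_rank_one {K : Type} [Field K] [CharZero K] {ℓ : ℕ} [Fact ℓ.Prime]
    (r : FramedGaloisRep K (PadicAlgCl ℓ) 1) (σ : absoluteGaloisGroup K) :
    ‖((r σ : GL (Fin 1) (PadicAlgCl ℓ)) : Matrix (Fin 1) (Fin 1) (PadicAlgCl ℓ)) 0 0‖ = 1 := by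
  set e : absoluteGaloisGroup K → PadicAlgCl ℓ := fun τ =>
    ((r τ : GL (Fin 1) (PadicAlgCl ℓ)) : Matrix (Fin 1) (Fin 1) (PadicAlgCl ℓ)) 0 0 with he
  have hmul : ∀ τ τ' : absoluteGaloisGroup K, e (τ * τ') = e τ * e τ' := fun τ τ' => by
    simp only [he, map_mul, Units.val_mul, Matrix.mul_apply, Fin.sum_univ_one]
  have hone : e 1 = 1 := by simp [he]
  have hdet : ∀ τ : absoluteGaloisGroup K,
      e τ = ((Matrix.GeneralLinearGroup.det (r τ) : (PadicAlgCl ℓ)ˣ) : PadicAlgCl ℓ) := fun τ => by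
    rw [Matrix.GeneralLinearGroup.val_det_apply, Matrix.det_fin_one]
  have hne : ∀ τ : absoluteGaloisGroup K, e τ ≠ 0 := fun τ => by
    rw [hdet]
    exact Units.ne_zero _
  have hcont : Continuous e :=
    (Units.continuous_val.comp (map_continuous r)).matrix_elem 0 0
  let f : absoluteGaloisGroup K →* ℝ :=
    { toFun := fun τ => ‖e τ‖
      map_one' := by rw [hone, norm_one]
      map_mul' := fun τ τ' => by rw [hmul, norm_mul] }
  have hpos : ∀ τ, 0 < f τ := fun τ => norm_pos_iff.mpr (hne τ)
  obtain ⟨B, hB⟩ := (isCompact_range hcont.norm).bddAbove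
  have hB' : ∀ τ, f τ ≤ B := fun τ => hB ⟨τ, rfl⟩
  exact MonoidHom.eq_one_of_pos_of_bddAbove f hpos hB' σ

/-- **Rank-one Frobenius values are `ℓ`-adic units.**  If `r : Γ_K → GL₁(ℚ̄_ℓ)` has arithmetic-Frobenius
characteristic polynomial `X - a` at a finite place `v` of the number field `K`, then `‖a‖ = 1`:
a Frobenius `Φ` at a prime `𝔓 ∣ v` exists (`primesAbove_nonempty`,
`exists_isArithFrobAt_of_mem_primesAbove_holds`) and `(r Φ)₀₀ = a` (`hasFrobCharpolyAt_iff_of_rank_one`).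
[folklore] -/
theorem norm_eq_one_of_hasFrobCharpolyAt {K : Type} [Field K] [NumberField K] {ℓ : ℕ} [Fact ℓ.Prime]
    (r : FramedGaloisRep K (PadicAlgCl ℓ) 1) (v : HeightOneSpectrum (𝓞 K)) {a : PadicAlgCl ℓ}
    (h : r.HasFrobCharpolyAt v (X - C a)) : ‖a‖ = 1 := by
  obtain ⟨𝔓, h𝔓⟩ := HeightOneSpectrum.primesAbove_nonempty v
  obtain ⟨Φ, hΦ⟩ := HeightOneSpectrum.exists_isArithFrobAt_of_mem_primesAbove_holds (v := v) h𝔓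
  rw [← (r.hasFrobCharpolyAt_iff_of_rank_one v a).mp h 𝔓 h𝔓 Φ hΦ]
  exact norm_apply_eq_one_of_rank_one r Φ

/-- **Residue cardinalities above `ℓ` are not `ℓ`-adic units**: if `ℓ ∈ v` then `‖(N v : ℚ̄_ℓ)‖ < 1`
(`ℓ ∣ N v`, since `N v ∈ v` — `Ideal.absNorm_mem` — and `ℓ`, `N v` coprime would put `1 ∈ v`).
[folklore] -/
theorem norm_residueCard_lt_one {K : Type} [Field K] [NumberField K] {ℓ : ℕ} [Fact ℓ.Prime]
    {v : HeightOneSpectrum (𝓞 K)} (hv : ((ℓ : ℕ) : 𝓞 K) ∈ v.asIdeal) :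
    ‖((v.residueCard : ℕ) : PadicAlgCl ℓ)‖ < 1 := by
  have hℓ : ℓ.Prime := Fact.out
  have hdvd : ℓ ∣ v.residueCard := by
    by_contra hnd
    have hcop : Nat.Coprime ℓ v.residueCard := (Nat.Prime.coprime_iff_not_dvd hℓ).mpr hnd
    have hq : ((v.residueCard : ℕ) : 𝓞 K) ∈ v.asIdeal := Ideal.absNorm_mem v.asIdeal
    obtain ⟨a, b, hab⟩ := Nat.isCoprime_iff_coprime.mpr hcop
    have h1 : (1 : 𝓞 K) ∈ v.asIdeal := by
      have := congrArg (Int.castRingHom (𝓞 K)) hab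
      simp only [map_add, map_mul, map_one, eq_intCast, Int.cast_natCast] at this
      rw [← this]
      exact v.asIdeal.add_mem (v.asIdeal.mul_mem_left _ hv) (v.asIdeal.mul_mem_left _ hq)
    exact v.isPrime.ne_top ((Ideal.eq_top_iff_one _).mpr h1)
  obtain ⟨m, hm⟩ := hdvd
  rw [hm, Nat.cast_mul, norm_mul]
  have hlt : ‖(ℓ : PadicAlgCl ℓ)‖ < 1 := PadicAlgCl.norm_natCast_p_lt_one ℓ
  have hle : ‖(m : PadicAlgCl ℓ)‖ ≤ 1 := IsUltrametricDist.norm_natCast_le_one _ m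
  calc ‖(ℓ : PadicAlgCl ℓ)‖ * ‖(m : PadicAlgCl ℓ)‖ ≤ ‖(ℓ : PadicAlgCl ℓ)‖ * 1 :=
        mul_le_mul_of_nonneg_left hle (norm_nonneg _)
    _ < 1 := by rw [mul_one]; exact hlt

/-! ### Automorphic side: the `GL₁` datum of the norm character `‖·‖` -/

section NormDatum

variable (K : Type) [Field K] [NumberField K]

/-- **The cuspidal datum `π_{‖·‖} = ℂ·‖det‖ / ⊥` on `GL₁(𝔸_K)`** exists
(`exists_automorphicRepData_detTwist_glOne`; on `GL₁` the cusp condition is empty).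
[cite: BorelJacquet1979, 4.6] -/
theorem exists_normDatum (hcpt : isCompact_glFiniteIntegralLevel 1 K) :
    ∃ π : CuspidalAutomorphicRepData 1 K hcpt,
      π.1.W = Submodule.span ℂ {fun g : (AdelicGroupData.gl 1 K).Adelic =>
        (detTwist 1 (HeckeCharacter.normCharacter K) g : ℂ)} ∧ π.1.W' = ⊥ := by
  obtain ⟨τ, hW, hW'⟩ :=
    exists_automorphicRepData_detTwist_glOne hcpt (HeckeCharacter.normCharacter K)
  have hcusp : τ.W ≤ cuspFormsGL 1 K hcpt := by
    rw [hW, Submodule.span_le]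
    rintro _ rfl
    exact IsCuspFormGL.mem_cuspFormsGL
      ⟨isAutomorphicForm_detTwist_glOne hcpt _, fun k hk hk1 => absurd hk1 (by omega)⟩
  exact ⟨⟨τ, hcusp⟩, hW, hW'⟩

variable {K}
variable {hcpt : isCompact_glFiniteIntegralLevel 1 K}

/-- On the line `ℂ·(θ∘det)`, `GL₁(𝔸_K)` acts through the Hecke character `θ`:
`r(g) φ - θ(det g) φ = 0 ∈ W'` (`rightTranslation_detTwist_glOne`). [folklore] -/
theorem heckeCharacter_of_span (π : AutomorphicRepData (AutomorphyDatum.gl 1 K hcpt))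
    (θ : HeckeCharacter K)
    (hW : π.W = Submodule.span ℂ {fun g : (AdelicGroupData.gl 1 K).Adelic => (detTwist 1 θ g : ℂ)}) :
    ∀ (g : (AdelicGroupData.gl 1 K).Adelic), ∀ φ ∈ π.W,
      rightTranslation (AdelicGroupData.gl 1 K) g φ -
        ((θ (Matrix.GeneralLinearGroup.det g) : ℂˣ) : ℂ) • φ ∈ π.W' := by
  intro g φ hφ
  rw [hW] at hφ
  obtain ⟨c, rfl⟩ := Submodule.mem_span_singleton.mp hφ
  rw [map_smul, rightTranslation_detTwist_glOne, detTwist_apply, smul_comm c, sub_self]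
  exact Submodule.zero_mem _

/-- **`π_{‖·‖}` is regular algebraic.**  `‖·‖` is algebraic (`isAlgebraic_normCharacter`, infinity
type `(p, q)` integral), so `π_{‖·‖}` has an infinity type `T` with `a`-multiset `{-n_ι}` at each
embedding (`exists_hasInfinityType_of_hasInfinityType_heckeCharacter_glOne`); for `n = 1`,
`(n-1)/2 = 0`, so integrality of `a` (and of `b = a - m`) is C-algebraicity, and a singleton is
regular.  (Clozel 1990, §3.3, `n = 1`.) [cite: Clozel1990, §3.3] -/
theorem isRegularAlgebraic_normDatum (π : AutomorphicRepData (AutomorphyDatum.gl 1 K hcpt))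
    (hW : π.W = Submodule.span ℂ {fun g : (AdelicGroupData.gl 1 K).Adelic =>
      (detTwist 1 (HeckeCharacter.normCharacter K) g : ℂ)}) :
    π.IsRegularAlgebraic := by
  have hχ := heckeCharacter_of_span π _ hW
  obtain ⟨p, q, hpq⟩ := (HeckeCharacter.isAlgebraic_iff_exists_hasInfinityType _).mp
    (HeckeCharacter.isAlgebraic_normCharacter (K := K))
  obtain ⟨T, hT, hTa⟩ := π.exists_hasInfinityType_of_hasInfinityType_heckeCharacter_glOne hχ hpq
  refine ⟨T, hT, ?_, ?_⟩
  · intro σ w hw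
    have ha : w.a = -((HeckeCharacter.embExponent p q σ : ℤ) : ℂ) := by
      have hmem : w.a ∈ (T σ).map ArchWeight.a := Multiset.mem_map_of_mem _ hw
      rw [hTa σ, Multiset.mem_singleton] at hmem
      exact hmem
    obtain ⟨m, hm⟩ := w.exists_int_sub
    have hb : w.b = w.a - m := by rw [← hm]; ring
    refine ⟨-HeckeCharacter.embExponent p q σ, -HeckeCharacter.embExponent p q σ - m, ?_, ?_⟩
    · rw [ha]; push_cast; ring
    · rw [hb, ha]; push_cast; ring
  · intro σ
    rw [hTa σ]
    exact Multiset.nodup_singleton _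

/-- **Satake parameters of `π_{‖·‖}`**: any Satake parameter at `v` is `{(N v)⁻¹}` — it is
`{‖ϖ_v‖}` for a uniformizer `ϖ_v` (`exists_eq_singleton_of_hasSatakeParamAt_glOne`), `‖·‖` is
unramified at `v`, and `‖ϖ_v‖ = (N v)⁻¹` (`valueAtUniformizer_normCharacter`).  Tate (1950) §4.3.
[cite: TateThesis1967, §4.3] -/
theorem satakeParam_eq_of_normDatum (π : AutomorphicRepData (AutomorphyDatum.gl 1 K hcpt))
    (hW : π.W = Submodule.span ℂ {fun g : (AdelicGroupData.gl 1 K).Adelic =>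
      (detTwist 1 (HeckeCharacter.normCharacter K) g : ℂ)})
    {v : HeightOneSpectrum (𝓞 K)} {α : Multiset ℂ} (hα : π.HasSatakeParamAt v α) :
    α = {((v.residueCard : ℂ))⁻¹} := by
  have hχ := heckeCharacter_of_span π _ hW
  obtain ⟨ϖ, hϖ, rfl⟩ := π.exists_eq_singleton_of_hasSatakeParamAt_glOne hχ hα
  have hur : (HeckeCharacter.normCharacter K).IsUnramifiedAt v :=
    HeckeCharacter.isUnramifiedAt_normCharacter v
  rw [← HeckeCharacter.localComponent_apply,
    HeckeCharacter.localComponent_eq_valueAtUniformizer hur hϖ,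
    HeckeCharacter.valueAtUniformizer_normCharacter]

/-- **`π_{‖·‖}` has a Satake parameter at some finite place** (indeed off any level `𝔪` of `‖·‖`,
`hasSatakeParamAt_detTwist_glOne`; a number field has infinitely many places and `𝔪 ≠ 0` finitely
many prime factors). [folklore] -/
theorem exists_hasSatakeParamAt_normDatum (π : AutomorphicRepData (AutomorphyDatum.gl 1 K hcpt))
    (hW : π.W = Submodule.span ℂ {fun g : (AdelicGroupData.gl 1 K).Adelic =>
      (detTwist 1 (HeckeCharacter.normCharacter K) g : ℂ)}) (hW' : π.W' = ⊥) :
    ∃ (v : HeightOneSpectrum (𝓞 K)) (α : Multiset ℂ), π.HasSatakeParamAt v α := by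
  obtain ⟨𝔪, h𝔪, hθ𝔪⟩ := HeckeCharacter.exists_level_glOne (HeckeCharacter.normCharacter K)
  haveI := SorensenPatching.infinite_heightOneSpectrum K
  obtain ⟨v, hv⟩ : ∃ v : HeightOneSpectrum (𝓞 K), ¬ v.asIdeal ∣ 𝔪 := by
    by_contra! h
    exact Set.infinite_univ ((Ideal.finite_factors h𝔪).subset fun v _ => h v)
  exact ⟨v, _, AutomorphicRepData.hasSatakeParamAt_detTwist_glOne hcpt hW hW' h𝔪 hθ𝔪 v hv
    (HeckeCharacter.valued_uniformizer (K := K) v)⟩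

/-- **No rank-one `ℓ`-adic character has the predicted Frobenius polynomial of `π_{‖·‖}` at a place
above `ℓ`** — for EVERY number field `K`, prime `ℓ`, field isomorphism `ι : ℚ̄_ℓ ≃+* ℂ`, place `v ∋ ℓ`
and Satake parameter `α` of `π_{‖·‖}` at `v`: the predicted polynomial is `X - N v`
(`satakeParam_eq_of_normDatum`, `arithFrobPolyOfSatake_one`), a Frobenius value `N v` would be an
`ℓ`-adic unit (`norm_eq_one_of_hasFrobCharpolyAt`), but `‖N v‖_ℓ < 1` (`norm_residueCard_lt_one`).
[folklore] -/
theorem not_hasFrobCharpolyAt_normDatum_above (π : AutomorphicRepData (AutomorphyDatum.gl 1 K hcpt))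
    (hW : π.W = Submodule.span ℂ {fun g : (AdelicGroupData.gl 1 K).Adelic =>
      (detTwist 1 (HeckeCharacter.normCharacter K) g : ℂ)})
    {ℓ : ℕ} [Fact ℓ.Prime] (ι : PadicAlgCl ℓ ≃+* ℂ) {v : HeightOneSpectrum (𝓞 K)}
    (hv : ((ℓ : ℕ) : 𝓞 K) ∈ v.asIdeal) {α : Multiset ℂ} (hα : π.HasSatakeParamAt v α)
    (r : FramedGaloisRep K (PadicAlgCl ℓ) 1) :
    ¬ r.HasFrobCharpolyAt v (arithFrobPolyOfSatake ι v.residueCard 1 α) := by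
  intro hfrob
  rw [satakeParam_eq_of_normDatum π hW hα, arithFrobPolyOfSatake_one, Multiset.map_singleton,
    Multiset.prod_singleton, inv_inv, map_natCast] at hfrob
  have h1 := norm_eq_one_of_hasFrobCharpolyAt r v hfrob
  exact (norm_residueCard_lt_one (K := K) hv).ne h1

end NormDatum

/-! ### The negative lemma -/

/-- **Any proof of `GaloisRepOfRegularAlgebraic` must use the guard `v ∤ ℓ`**: the crux with
`((ℓ : ℕ) : 𝓞 K) ∉ v.asIdeal →` deleted is FALSE.  Witness: `n = 1`, `K = ℚ` (totally real),
`π = π_{‖·‖}` (cuspidal, regular algebraic: `isRegularAlgebraic_normDatum`), `v` any place carrying a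
Satake parameter of `π` (`exists_hasSatakeParamAt_normDatum`), `ℓ` the prime below `v`
(`exists_natPrime_natCast_mem`), `ι` any (`PadicAlgCl.nonempty_ringEquiv_complex`): the `r` provided
would have Frobenius polynomial `X - N v` at `v ∣ ℓ`, excluded by
`not_hasFrobCharpolyAt_normDatum_above`.  (The genuine `r_{ℓ,ι}(π_{‖·‖})` is the cyclotomic character,
ramified at `ℓ`: Serre 1968, Ch. I §1.2.) [cite: SerreAbelianLadic1968, Ch. I §1.2] -/
theorem not_crux_without_primeToEll_inline :
    ¬ ∀ (n : ℕ) (K : Type) [Field K] [NumberField K] (hcpt : isCompact_glFiniteIntegralLevel n K),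
      (IsTotallyReal K ∨ IsCMField K) → ∀ (π : CuspidalAutomorphicRepData n K hcpt),
      π.1.IsRegularAlgebraic → ∀ (ℓ : ℕ) [Fact ℓ.Prime] (ι : PadicAlgCl ℓ ≃+* ℂ),
      ∃ r : FramedGaloisRep K (PadicAlgCl ℓ) n, r.toGaloisRep.IsSemisimple ∧
        ∀ (v : HeightOneSpectrum (𝓞 K)) (α : Multiset ℂ), π.1.HasSatakeParamAt v α →
          r.IsUnramifiedAt v ∧
            r.HasFrobCharpolyAt v (arithFrobPolyOfSatake ι v.residueCard n α) := by
  intro H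
  have hcpt : isCompact_glFiniteIntegralLevel 1 ℚ := isCompact_glFiniteIntegralLevel_holds 1 ℚ
  obtain ⟨π, hW, hW'⟩ := exists_normDatum ℚ hcpt
  obtain ⟨v, α, hα⟩ := exists_hasSatakeParamAt_normDatum π.1 hW hW'
  obtain ⟨ℓ, hℓ, hℓv⟩ := exists_natPrime_natCast_mem v
  haveI : Fact ℓ.Prime := ⟨hℓ⟩
  obtain ⟨ι⟩ := PadicAlgCl.nonempty_ringEquiv_complex ℓ
  have hRA : π.1.IsRegularAlgebraic := isRegularAlgebraic_normDatum π.1 hW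
  obtain ⟨r, -, hr⟩ := H 1 ℚ hcpt (Or.inl inferInstance) π hRA ℓ ι
  exact not_hasFrobCharpolyAt_normDatum_above π.1 hW ι hℓv hα r (hr v α hα).2


/-! ## § GL₁ bookkeeping -/

/-- Powers of a `1 × 1` invertible matrix, entrywise. [folklore] -/
theorem gl_one_pow_apply {A : Type*} [CommRing A] (g : GL (Fin 1) A) (k : ℕ) :
    ((g ^ k : GL (Fin 1) A) : Matrix (Fin 1) (Fin 1) A) 0 0 =
      (((g : GL (Fin 1) A) : Matrix (Fin 1) (Fin 1) A) 0 0) ^ k := by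
  induction k with
  | zero => simp
  | succ k ih => rw [pow_succ, Units.val_mul, Matrix.mul_apply, Fin.sum_univ_one, ih, pow_succ]

/-! ## § LoadBearing — the crux with one hypothesis dropped -/

/-- **Crux without the guard `v ∤ ℓ`** (compatibility demanded also above `ℓ`).  FALSE:
`galoisRepOfRegularAlgebraic_false_without_primeToEll` (landed: p99994,
`Theorems/GaloisRepOfRegularAlgebraic/Negative/FalseWithoutPrimeToEll.lean`). -/
def GaloisRepOfRegularAlgebraicWithoutPrimeToEll : Prop :=
  ∀ (n : ℕ) (K : Type) [Field K] [NumberField K] (hcpt : isCompact_glFiniteIntegralLevel n K),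
    (IsTotallyReal K ∨ IsCMField K) → ∀ (π : CuspidalAutomorphicRepData n K hcpt),
    π.1.IsRegularAlgebraic → ∀ (ℓ : ℕ) [Fact ℓ.Prime] (ι : PadicAlgCl ℓ ≃+* ℂ),
    ∃ r : FramedGaloisRep K (PadicAlgCl ℓ) n, r.toGaloisRep.IsSemisimple ∧
      ∀ (v : HeightOneSpectrum (𝓞 K)) (α : Multiset ℂ), π.1.HasSatakeParamAt v α →
        r.IsUnramifiedAt v ∧ r.HasFrobCharpolyAt v (arithFrobPolyOfSatake ι v.residueCard n α)

/-- **Any proof of the crux must use `v ∤ ℓ`** — PROVED (witness `n = 1`, `K = ℚ`, `π_{‖·‖}`,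
`v ∣ ℓ`; see the module docstring). -/
theorem galoisRepOfRegularAlgebraic_false_without_primeToEll :
    ¬ GaloisRepOfRegularAlgebraicWithoutPrimeToEll := by
  intro H
  have hcpt : isCompact_glFiniteIntegralLevel 1 ℚ := isCompact_glFiniteIntegralLevel_holds 1 ℚ
  obtain ⟨π, hW, hW'⟩ := exists_normDatum ℚ hcpt
  obtain ⟨v, α, hα⟩ := exists_hasSatakeParamAt_normDatum π.1 hW hW'
  obtain ⟨ℓ, hℓ, hℓv⟩ := exists_natPrime_natCast_mem v
  haveI : Fact ℓ.Prime := ⟨hℓ⟩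
  obtain ⟨ι⟩ := PadicAlgCl.nonempty_ringEquiv_complex ℓ
  have hRA : π.1.IsRegularAlgebraic := isRegularAlgebraic_normDatum π.1 hW
  obtain ⟨r, -, hr⟩ := H 1 ℚ hcpt (Or.inl inferInstance) π hRA ℓ ι
  exact not_hasFrobCharpolyAt_normDatum_above π.1 hW ι hℓv hα r (hr v α hα).2

/-- **Crux without `IsRegularAlgebraic`** (Galois representations for ALL cuspidal `π`).  FALSE —
witness `π_{‖·‖^{1/2}}` on `GL₁/ℚ` (not of type `A₀`): its Satake parameter at `p` is `{p^{-1/2}}`,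
the predicted arithmetic-Frobenius value is `s_p = ι⁻¹(√p)` with `s_p² = p = χ_ℓ(Frob_p)`; a
compatible `r` would have `r ⊗ r` and `χ_ℓ` agreeing at all Frobenii `p ≠ ℓ`, hence
`r ⊗ r ≃ χ_ℓ` (Chebotarev + rank one: `nonempty_equiv_of_hasFrobCharpolyAt_eventually
chebotarev_artinRep_holds`), and at a complex conjugation `c` (`exists_isComplexConjugation`):
`r(c)² = r(c²) = 1` but `χ_ℓ(c) = -1` (`cyclotomicCharacter_of_isComplexConjugation`). -/
def GaloisRepOfRegularAlgebraicWithoutRegularAlgebraic : Prop :=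
  ∀ (n : ℕ) (K : Type) [Field K] [NumberField K] (hcpt : isCompact_glFiniteIntegralLevel n K),
    (IsTotallyReal K ∨ IsCMField K) → ∀ (π : CuspidalAutomorphicRepData n K hcpt),
    ∀ (ℓ : ℕ) [Fact ℓ.Prime] (ι : PadicAlgCl ℓ ≃+* ℂ),
    ∃ r : FramedGaloisRep K (PadicAlgCl ℓ) n, r.toGaloisRep.IsSemisimple ∧
      ∀ (v : HeightOneSpectrum (𝓞 K)) (α : Multiset ℂ), π.1.HasSatakeParamAt v α →
        ((ℓ : ℕ) : 𝓞 K) ∉ v.asIdeal →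
          r.IsUnramifiedAt v ∧ r.HasFrobCharpolyAt v (arithFrobPolyOfSatake ι v.residueCard n α)

/-- `GL₁` is commutative: conjugation is trivial on `1 × 1` invertible matrices. [folklore] -/
theorem gl_one_conj_eq {A : Type*} [CommRing A] (P g : GL (Fin 1) A) : P * g * P⁻¹ = g := by
  have hcomm : P * g = g * P := by
    refine Units.ext (Matrix.ext fun i j => ?_)
    rw [Subsingleton.elim i 0, Subsingleton.elim j 0]
    simp only [Units.val_mul, Matrix.mul_apply, Fin.sum_univ_one]
    exact mul_comm _ _
  rw [hcomm, mul_inv_cancel_right]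

/-- **There is a Hecke character `θ = ‖·‖^{1/2}`**: `θ(x) = √‖x‖` for every idele `x` (continuous:
`continuous_ideleNorm_holds` and continuity of `√·`; trivial on `Kˣ` by the product formula
`ideleNorm_principal`).  It is a norm twist (`z = 1/2`), hence unramified everywhere with
`θ(ϖ_v) = (N v)^{-1/2}`.  Tate (1950) §4.3: the quasi-characters trivial on `𝕀¹_K` are the `‖·‖^s`.
[cite: TateThesis1967, §4.3, p. 339] -/
theorem exists_halfNormCharacter (K : Type) [Field K] [NumberField K] :
    ∃ θ : HeckeCharacter K, ∀ x : ideleGroup K, ((θ x : ℂˣ) : ℂ) =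
      (Real.sqrt (Literature.NumberTheory.GaloisRepresentations.ideleNorm x) : ℂ) := by
  let f : ℝ≥0 →* ℂ :=
    (Complex.ofRealHom : ℝ →+* ℂ).toMonoidHom.comp
      (NNReal.toRealHom.toMonoidHom.comp (NNReal.sqrtHom : ℝ≥0 →*₀ ℝ≥0).toMonoidHom)
  have hf : Continuous f :=
    Complex.continuous_ofReal.comp (NNReal.continuous_coe.comp NNReal.continuous_sqrt)
  have hfapply : ∀ y : ℝ≥0, f y = ((NNReal.sqrt y : ℝ) : ℂ) := fun y => rfl
  have hcont : Continuous ((Units.map f).comp (ideleNormUnits K)) := by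
    refine (Continuous.units_map _ hf).comp ?_
    exact Units.continuous_iff.mpr ⟨continuous_ideleNorm_holds K,
      ((continuous_ideleNorm_holds K).comp continuous_inv).congr fun _ => rfl⟩
  let θc : ideleGroup K →ₜ* ℂˣ :=
    { toMonoidHom := (Units.map f).comp (ideleNormUnits K), continuous_toFun := hcont }
  have hθc : ∀ x, ((θc x : ℂˣ) : ℂ) = f (IdeleClassGroup.ideleNorm K x) := fun x => rfl
  refine ⟨⟨θc, fun x hx => ?_⟩, fun x => ?_⟩
  · refine Units.ext ?_
    rw [hθc, ideleNorm_principal hx, map_one, Units.val_one]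
  · change ((θc x : ℂˣ) : ℂ) = _
    rw [hθc, hfapply, Real.coe_sqrt, coe_ideleNorm]

/-- **Any proof of `GaloisRepOfRegularAlgebraic` must use `IsRegularAlgebraic`**: the crux with the
hypothesis `π.1.IsRegularAlgebraic →` deleted is FALSE (witness `π_{‖·‖^{1/2}}` on `GL₁/ℚ`; see the
module docstring).  [cite: SerreAbelianLadic1968, Ch. I §2.3 and Ch. III §3] -/
theorem not_crux_without_regularAlgebraic_inline :
    ¬ ∀ (n : ℕ) (K : Type) [Field K] [NumberField K] (hcpt : isCompact_glFiniteIntegralLevel n K),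
      (IsTotallyReal K ∨ IsCMField K) → ∀ (π : CuspidalAutomorphicRepData n K hcpt),
      ∀ (ℓ : ℕ) [Fact ℓ.Prime] (ι : PadicAlgCl ℓ ≃+* ℂ),
      ∃ r : FramedGaloisRep K (PadicAlgCl ℓ) n, r.toGaloisRep.IsSemisimple ∧
        ∀ (v : HeightOneSpectrum (𝓞 K)) (α : Multiset ℂ), π.1.HasSatakeParamAt v α →
          ((ℓ : ℕ) : 𝓞 K) ∉ v.asIdeal →
            r.IsUnramifiedAt v ∧
              r.HasFrobCharpolyAt v (arithFrobPolyOfSatake ι v.residueCard n α) := by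
  intro H
  -- the datum of `‖·‖^{1/2}` on `GL₁/ℚ`, with its Satake parameters almost everywhere
  have hcpt : isCompact_glFiniteIntegralLevel 1 ℚ := isCompact_glFiniteIntegralLevel_holds 1 ℚ
  obtain ⟨θ, hθ⟩ := exists_halfNormCharacter ℚ
  obtain ⟨τ, hτ⟩ := exists_cuspidal_glOne_hasSatakeParamAt_valueAtUniformizer hcpt θ
  -- the prime `ℓ = 2` and any `ι`
  haveI : Fact (Nat.Prime 2) := ⟨Nat.prime_two⟩
  obtain ⟨ι⟩ := PadicAlgCl.nonempty_ringEquiv_complex 2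
  obtain ⟨r, -, hr⟩ := H 1 ℚ hcpt (Or.inl inferInstance) τ 2 ι
  -- the value of `θ` at uniformizers: `(N v)^{-1/2}`
  have hθtwist : θ.IsNormTwist := by
    refine ⟨((1 / 2 : ℝ) : ℂ), fun x => ?_⟩
    rw [hθ x, Real.sqrt_eq_rpow, Complex.ofReal_cpow (by rw [← coe_ideleNorm]; exact NNReal.coe_nonneg _)]
  have hval : ∀ v : HeightOneSpectrum (𝓞 ℚ),
      θ.valueAtUniformizer v = ((Real.sqrt (v.residueCard : ℝ) : ℝ) : ℂ)⁻¹ := fun v => by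
    rw [HeckeCharacter.valueAtUniformizer, HeckeCharacter.localComponent_apply, hθ,
      Literature.NumberTheory.GaloisRepresentations.ideleNorm_localUnits, HeckeCharacter.norm_uniformizer,
      Real.sqrt_inv, Complex.ofReal_inv]
    rfl
  -- the predicted Frobenius value `s_v = ι⁻¹ √(N v)` squares to `N v`
  have hsq : ∀ v : HeightOneSpectrum (𝓞 ℚ),
      ι.symm ((Real.sqrt (v.residueCard : ℝ) : ℝ) : ℂ) * ι.symm ((Real.sqrt (v.residueCard : ℝ) : ℝ) : ℂ)
        = (v.residueCard : PadicAlgCl 2) := fun v => by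
    rw [← map_mul, ← Complex.ofReal_mul, Real.mul_self_sqrt (Nat.cast_nonneg _),
      Complex.ofReal_natCast, map_natCast]
  -- `r² = det r · det r` as a rank-one framed representation
  set sqHom : (PadicAlgCl 2)ˣ →ₜ* (PadicAlgCl 2)ˣ :=
    { toMonoidHom := powMonoidHom 2, continuous_toFun := continuous_pow 2 } with hsqdef
  set r2 : FramedGaloisRep ℚ (PadicAlgCl 2) 1 :=
    ContinuousMonoidHom.comp
      (FramedRep.unitsContinuousMulEquivOfUnique (Fin 1) (PadicAlgCl 2) :
        (PadicAlgCl 2)ˣ →ₜ* GL (Fin 1) (PadicAlgCl 2))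
      (sqHom.comp (FramedRep.det r)) with hr2def
  have hr2 : ∀ σ : absoluteGaloisGroup ℚ,
      ((r2 σ : GL (Fin 1) (PadicAlgCl 2)) : Matrix (Fin 1) (Fin 1) (PadicAlgCl 2)) 0 0 =
        ((r σ : GL (Fin 1) (PadicAlgCl 2)) : Matrix (Fin 1) (Fin 1) (PadicAlgCl 2)) 0 0 ^ 2 := by
    intro σ
    simp only [hr2def, hsqdef, ContinuousMonoidHom.comp_toFun, FramedRep.det_apply]
    rw [show (FramedRep.unitsContinuousMulEquivOfUnique (Fin 1) (PadicAlgCl 2) :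
        (PadicAlgCl 2)ˣ →ₜ* GL (Fin 1) (PadicAlgCl 2)) = fun a =>
          FramedRep.unitsContinuousMulEquivOfUnique (Fin 1) (PadicAlgCl 2) a from rfl]
    simp only [FramedRep.unitsContinuousMulEquivOfUnique_apply_coe]
    change (((powMonoidHom 2) (Matrix.GeneralLinearGroup.det (r σ)) : (PadicAlgCl 2)ˣ) :
      PadicAlgCl 2) = _
    rw [powMonoidHom_apply, Units.val_pow_eq_pow_val, Matrix.GeneralLinearGroup.val_det_apply,
      Matrix.det_fin_one]
  -- the cyclotomic character `ψ = χ_2 : Γ_ℚ → GL₁(ℚ̄₂)`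
  obtain ⟨ψ, hψ⟩ := FramedGaloisRep.exists_cyclotomic_padicAlgCl ℚ 2
  -- `r²` and `ψ` have the same Frobenius polynomial `X - N v` at almost every `v`
  have hgood : ∀ᶠ v : HeightOneSpectrum (𝓞 ℚ) in cofinite,
      r2.IsUnramifiedAt v ∧ ψ.IsUnramifiedAt v ∧
        ∃ P : Polynomial (PadicAlgCl 2), r2.HasFrobCharpolyAt v P ∧ ψ.HasFrobCharpolyAt v P := by
    filter_upwards [FramedGaloisRep.eventually_natCast_not_mem ℚ 2, hτ] with v hv hsat
    obtain ⟨hunr, hfrob⟩ := hr v _ hsat hv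
    rw [hval v, arithFrobPolyOfSatake_one, Multiset.map_singleton, Multiset.prod_singleton,
      inv_inv] at hfrob
    have hentry := (r.hasFrobCharpolyAt_iff_of_rank_one v _).mp hfrob
    refine ⟨?_, ψ.isUnramifiedAt_of_cyclotomic hψ hv, X - C (v.residueCard : PadicAlgCl 2), ?_,
      ψ.hasFrobCharpolyAt_natCast_of_cyclotomic hψ hv⟩
    · intro 𝔓 h𝔓 σ hσ
      have h1 : r σ = 1 := hunr 𝔓 h𝔓 σ hσ
      simp only [hr2def, ContinuousMonoidHom.comp_toFun, FramedRep.det_apply, h1, map_one]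
    · refine (r2.hasFrobCharpolyAt_iff_of_rank_one v _).mpr fun 𝔓 h𝔓 Φ hΦ => ?_
      rw [hr2 Φ, hentry 𝔓 h𝔓 Φ hΦ, pow_two, hsq v]
  -- hence they are equivalent (Chebotarev + Brauer–Nesbitt, rank one), hence equal as characters
  obtain ⟨e⟩ := FramedGaloisRep.nonempty_equiv_of_hasFrobCharpolyAt_eventually
    chebotarev_artinRep_holds r2 ψ (FramedGaloisRep.isSemisimple_toGaloisRep_of_rank_one r2)
    (FramedGaloisRep.isSemisimple_toGaloisRep_of_rank_one ψ) hgood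
  obtain ⟨P, hP⟩ := FramedRep.exists_eq_conj_of_equiv r2 ψ e
  have heq : ∀ σ : absoluteGaloisGroup ℚ, ψ σ = r2 σ := fun σ => by
    rw [hP, FramedRep.conj_apply, gl_one_conj_eq]
  -- evaluate at a complex conjugation
  obtain ⟨c, hc⟩ := exists_isComplexConjugation (Rat.castHom ℝ)
  have hψc : ((ψ c : GL (Fin 1) (PadicAlgCl 2)) : Matrix (Fin 1) (Fin 1) (PadicAlgCl 2)) 0 0 = -1 := by
    rw [hψ c, GaloisRep.cyclotomicCharacter_of_isComplexConjugation 2 hc]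
    simp
  have hrc : ((r2 c : GL (Fin 1) (PadicAlgCl 2)) : Matrix (Fin 1) (Fin 1) (PadicAlgCl 2)) 0 0 = 1 := by
    rw [hr2 c, ← gl_one_pow_apply, ← map_pow, hc.sq_eq_one, map_one]
    simp
  have h : (-1 : PadicAlgCl 2) = 1 := by rw [← hψc, heq c, hrc]
  have h2 : (2 : PadicAlgCl 2) = 0 := by linear_combination -h
  exact two_ne_zero h2

/-- **Any proof of the crux must use `IsRegularAlgebraic`** — PROVED (witness `π_{‖·‖^{1/2}}` on
`GL₁/ℚ`, Chebotarev uniqueness against `χ_ℓ`, complex conjugation; landed as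
`Theorems/GaloisRepOfRegularAlgebraic/Negative/FalseWithoutRegularAlgebraic.lean`, p102360). -/
theorem galoisRepOfRegularAlgebraic_false_without_regularAlgebraic :
    ¬ GaloisRepOfRegularAlgebraicWithoutRegularAlgebraic :=
  not_crux_without_regularAlgebraic_inline

/-- **Crux without `IsTotallyReal K ∨ IsCMField K`** (Galois representations for regular algebraic
cuspidal `π` over an ARBITRARY number field).  OPEN PROBLEM (Clozel 1990 Conj. 4.5 / Fontaine–Mazur–
Langlands; known only over totally real and CM fields, where Shimura varieties / the
Harris–Lan–Taylor–Thorne–Scholze construction exist — `ShimuraVarietyRealizationBarrier` of the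
catalogue).  Not refutable and not provable here; recorded so that nobody re-runs the mutation. -/
def GaloisRepOfRegularAlgebraicWithoutCMorTR : Prop :=
  ∀ (n : ℕ) (K : Type) [Field K] [NumberField K] (hcpt : isCompact_glFiniteIntegralLevel n K),
    ∀ (π : CuspidalAutomorphicRepData n K hcpt),
    π.1.IsRegularAlgebraic → ∀ (ℓ : ℕ) [Fact ℓ.Prime] (ι : PadicAlgCl ℓ ≃+* ℂ),
    ∃ r : FramedGaloisRep K (PadicAlgCl ℓ) n, r.toGaloisRep.IsSemisimple ∧
      ∀ (v : HeightOneSpectrum (𝓞 K)) (α : Multiset ℂ), π.1.HasSatakeParamAt v α →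
        ((ℓ : ℕ) : 𝓞 K) ∉ v.asIdeal →
          r.IsUnramifiedAt v ∧ r.HasFrobCharpolyAt v (arithFrobPolyOfSatake ι v.residueCard n α)

/-- In ranks `n ≤ 1` the field hypothesis is NOT needed (`of_rank_le_one` is stated for every number
field): the CM/totally-real hypothesis is load-bearing only from `n = 2` on. -/
theorem galoisRepOfRegularAlgebraicWithoutCMorTR_rank_le_one :
    ∀ (n : ℕ), n ≤ 1 → ∀ (K : Type) [Field K] [NumberField K]
      (hcpt : isCompact_glFiniteIntegralLevel n K) (π : CuspidalAutomorphicRepData n K hcpt),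
      π.1.IsRegularAlgebraic → ∀ (ℓ : ℕ) [Fact ℓ.Prime] (ι : PadicAlgCl ℓ ≃+* ℂ),
      ∃ r : FramedGaloisRep K (PadicAlgCl ℓ) n, r.toGaloisRep.IsSemisimple ∧
        ∀ (v : HeightOneSpectrum (𝓞 K)) (α : Multiset ℂ), π.1.HasSatakeParamAt v α →
          ((ℓ : ℕ) : 𝓞 K) ∉ v.asIdeal →
            r.IsUnramifiedAt v ∧ r.HasFrobCharpolyAt v (arithFrobPolyOfSatake ι v.residueCard n α) := by
  intro n hn K _ _ hcpt π hπ ℓ _ ι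
  rcases Nat.le_one_iff_eq_zero_or_eq_one.mp hn with rfl | rfl
  · exact Summit.Langlands.Langlands.Theorems.GaloisRepOfRegularAlgebraic.rank_zero K hcpt π ℓ ι
  · exact Summit.Langlands.Langlands.Theorems.GaloisRepOfRegularAlgebraic.rank_one K hcpt π hπ ℓ ι

/-! ## § Strengthenings — natural strengthenings of the conclusion, refuted -/

/-- **The crux with "`r σ` of finite order for every `σ`" added is FALSE** (the crux is genuinely
`ℓ`-adic: `r_{ℓ,ι}(π_{‖·‖}) = χ_ℓ` has `χ_ℓ(Frob_v) = N v` of infinite order).  Witness `n = 1`,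
`K = ℚ`, `π_{‖·‖}`, a place `v` with a Satake parameter and a prime `ℓ` NOT below `v`: the Frobenius
value `N v > 1` would satisfy `(N v)^k = 1` in `ℚ̄_ℓ`. -/
theorem not_crux_with_finiteOrder :
    ¬ ∀ (n : ℕ) (K : Type) [Field K] [NumberField K] (hcpt : isCompact_glFiniteIntegralLevel n K),
      (IsTotallyReal K ∨ IsCMField K) → ∀ (π : CuspidalAutomorphicRepData n K hcpt),
      π.1.IsRegularAlgebraic → ∀ (ℓ : ℕ) [Fact ℓ.Prime] (ι : PadicAlgCl ℓ ≃+* ℂ),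
      ∃ r : FramedGaloisRep K (PadicAlgCl ℓ) n, (∀ σ, IsOfFinOrder (r σ)) ∧
        ∀ (v : HeightOneSpectrum (𝓞 K)) (α : Multiset ℂ), π.1.HasSatakeParamAt v α →
          ((ℓ : ℕ) : 𝓞 K) ∉ v.asIdeal →
            r.IsUnramifiedAt v ∧ r.HasFrobCharpolyAt v (arithFrobPolyOfSatake ι v.residueCard n α) := by
  intro H
  have hcpt : isCompact_glFiniteIntegralLevel 1 ℚ := isCompact_glFiniteIntegralLevel_holds 1 ℚ
  obtain ⟨π, hW, hW'⟩ := exists_normDatum ℚ hcpt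
  obtain ⟨v, α, hα⟩ := exists_hasSatakeParamAt_normDatum π.1 hW hW'
  obtain ⟨p, hp, hpv⟩ := exists_natPrime_natCast_mem v
  obtain ⟨ℓ, hℓp, hℓ⟩ := Nat.exists_infinite_primes (p + 1)
  haveI : Fact ℓ.Prime := ⟨hℓ⟩
  have hℓv : ((ℓ : ℕ) : 𝓞 ℚ) ∉ v.asIdeal :=
    natCast_not_mem_of_natCast_mem hp hℓ (by omega) hpv
  obtain ⟨ι⟩ := PadicAlgCl.nonempty_ringEquiv_complex ℓ
  have hRA : π.1.IsRegularAlgebraic := isRegularAlgebraic_normDatum π.1 hW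
  obtain ⟨r, hfin, hr⟩ := H 1 ℚ hcpt (Or.inl inferInstance) π hRA ℓ ι
  obtain ⟨-, hfrob⟩ := hr v α hα hℓv
  rw [satakeParam_eq_of_normDatum π.1 hW hα, arithFrobPolyOfSatake_one, Multiset.map_singleton,
    Multiset.prod_singleton, inv_inv, map_natCast] at hfrob
  obtain ⟨𝔓, h𝔓⟩ := HeightOneSpectrum.primesAbove_nonempty v
  obtain ⟨Φ, hΦ⟩ := HeightOneSpectrum.exists_isArithFrobAt_of_mem_primesAbove_holds (v := v) h𝔓
  have hval := (r.hasFrobCharpolyAt_iff_of_rank_one v _).mp hfrob 𝔓 h𝔓 Φ hΦ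
  obtain ⟨k, hk, hpow⟩ := (hfin Φ).exists_pow_eq_one
  have h1 : ((v.residueCard : ℕ) : PadicAlgCl ℓ) ^ k = 1 := by
    rw [← hval, ← gl_one_pow_apply, hpow]
    simp
  have h2 : (v.residueCard : ℕ) ^ k = 1 := by exact_mod_cast h1
  have h3 := HeightOneSpectrum.one_lt_residueCard v
  rcases k with _ | k
  · omega
  · rw [pow_succ] at h2
    have : v.residueCard ∣ 1 := ⟨v.residueCard ^ k, by rw [mul_comm]; exact h2.symm⟩
    exact absurd (Nat.le_of_dvd one_pos this) (by omega)

/-! ## § Line Sketch — the lead's stubs S1–S7 (all TRUE as typed); cheap findings for the workers -/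

/-- S4's hypothesis `0 ∉ α` and S7's `0 ∉ β` are REDUNDANT: the gap hypothesis at `a = b = 0`
already excludes `0` (this is how the composition derives `hα0`).  Prover info: drop them or keep
them, nothing changes. -/
theorem zero_not_mem_of_gap {k : Type*} [MulZeroClass k] {α : Multiset k} {q : k}
    (hgap : ∀ a ∈ α, ∀ b ∈ α, a ≠ q * b) : (0 : k) ∉ α :=
  fun h0 => hgap 0 h0 0 h0 (by rw [mul_zero])

/-- **S4 (`GapTransport`) is FALSE without `0 < q`** — only at the junk value `q = 0` (never a
residue cardinality): for `q = 0`, `n = 2`, `α = {1}` the hypotheses hold but the unique root of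
`arithFrobPolyOfSatake ι 0 2 {1} = X - ι⁻¹((√0 · 1)⁻¹) = X` is `0 = 0 · 0`.  So `0 < q` is
load-bearing exactly at junk. -/
theorem gapTransport_false_at_zero :
    ¬ ∀ {ℓ : ℕ} [Fact ℓ.Prime] (ι : PadicAlgCl ℓ ≃+* ℂ) (q n : ℕ),
      ∀ (α : Multiset ℂ), (0 : ℂ) ∉ α → (∀ a ∈ α, ∀ b ∈ α, a ≠ (q : ℂ) * b) →
      ∀ a ∈ (arithFrobPolyOfSatake ι q n α).roots, ∀ b ∈ (arithFrobPolyOfSatake ι q n α).roots,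
        a ≠ (q : PadicAlgCl ℓ) * b := by
  intro H
  haveI : Fact (Nat.Prime 2) := ⟨Nat.prime_two⟩
  obtain ⟨ι⟩ := PadicAlgCl.nonempty_ringEquiv_complex 2
  have hroots : (arithFrobPolyOfSatake ι 0 2 ({1} : Multiset ℂ)).roots = {0} := by
    rw [roots_arithFrobPolyOfSatake]
    simp
  have h := H ι 0 2 {1} (by simp) (by simp) 0 (by rw [hroots]; simp) 0 (by rw [hroots]; simp)
  exact h (by simp)

/-- **S5 (`MonodromyGap`) is FALSE without the gap hypothesis**: `Φ = N = 1` (`1 × 1` over `ℂ`),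
`q = 1`: `Φ N = 1 • N Φ` and `N ≠ 0`.  (Any proof of S5 must use the gap.) -/
theorem monodromyGap_false_without_gap :
    ¬ ∀ {k : Type} [Field k] [IsAlgClosed k] {n : ℕ} (Φ N : Matrix (Fin n) (Fin n) k) (q : k),
      Φ * N = q • (N * Φ) → N = 0 := by
  intro H
  have h := @H ℂ _ _ 1 1 1 1 (by simp)
  exact one_ne_zero h

/-- **S5's gap hypothesis is UNSATISFIABLE at `q = 1` in positive rank** (a characteristic
polynomial over an algebraically closed field has a root `a`, and `a = 1 · a`): S5 is vacuous there —
harmless, since the composition only uses `q = q_v ≥ 2`, but a prover should not look for content in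
that case. -/
theorem monodromyGap_hyp_false_at_one {k : Type*} [Field k] [IsAlgClosed k] {n : ℕ}
    (Φ : Matrix (Fin (n + 1)) (Fin (n + 1)) k) :
    ¬ ∀ a ∈ Φ.charpoly.roots, ∀ b ∈ Φ.charpoly.roots, a ≠ (1 : k) * b := by
  intro h
  have hdeg : Φ.charpoly.degree ≠ 0 := by
    rw [Polynomial.degree_eq_natDegree (Matrix.charpoly_monic Φ).ne_zero,
      Matrix.charpoly_natDegree_eq_dim, Fintype.card_fin]
    exact_mod_cast Nat.succ_ne_zero n
  obtain ⟨a, ha⟩ := IsAlgClosed.exists_root Φ.charpoly hdeg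
  have hmem : a ∈ Φ.charpoly.roots :=
    (Polynomial.mem_roots (Matrix.charpoly_monic Φ).ne_zero).mpr ha
  exact h a hmem a hmem (by rw [one_mul])

end Summit.Langlands.Langlands.Cruxes.GaloisRepOfRegularAlgebraic.Disproof

end
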